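import Literature.Analysis.Convolution.CompactlySupportedConvolutionAlgebra
import Literature.NumberTheory.Sieve.FordAsymptoticSievePrimeSums
import HarnessLib

/-!
# Ford's counterexamples to a fixed-level asymptotic sieve: Lemma 2.2 (all `r`)

Topic `Literature/NumberTheory/Sieve`, companion of `FordAsymptoticSieve.lean` (the named fact
`Literature.NumberTheory.Sieve.Ford2004_localConstruction` = [Ford2004] Theorem 3 with the choice
of `f_{1_M}` of the proof of Theorem 1) and sequel of `FordAsymptoticSievePrimeSums.lean`.
Source: K. Ford, *On Bombieri's asymptotic sieve*, Trans. Amer. Math. Soc. **357** (2005)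
1663–1674 (arXiv math/0401215) [Ford2004], §2, Lemma 2.2.

Lemma 2.2 of [Ford2004] evaluates `∑_{x ≤ n = p_1⋯p_r ≤ x+y} f(log p_1/log n, …, log p_r/log n)`
for a smooth symmetric `f` on the simplex as `(y/log x) ∫_{U_r} f/(u_1⋯u_r) + O(⋯)`, by induction
on `r`: `r = 1` is the prime number theorem and the step is partial summation in `p_1`. This
file PROVES the version consumed by the tree's formalisation of Theorem 3, in which the weight is
a PRODUCT `f(u) = ∏ u_i G(u_i)` (so the simplex integral is the `r`-fold additive convolution
`G^{*r}(log y/log x)`, `ConvFun.cpow` of `Literature.Analysis.Convolution.CompactlySupported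
ConvolutionAlgebra`), the interval is `(y, y(1+η)]` with `η = e^{−c₁√log x}` and the sum runs
over ORDERED tuples:

* `Ford2004.primeSum c₁ x G r y = Σ_r(y)` — the iterated prime sum
  `Σ_0(y) = [y < 1 ≤ y(1+η)]`, `Σ_{r+1}(y) = ∑_{p ≤ x²} t_p G(t_p) Σ_r(y/p)` (`t_p = log p/log x`);
* `Ford2004.primeSum_est` — **Lemma 2.2**: for `G` `K`-Lipschitz, bounded by `S`, living on
  `[ε, 2]`, `r ≥ 1`, `x ≥ xThreshold ε`, `c₁ ≤ c√ε/4` and `0 < y ≤ 2x`,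
  `‖Σ_r(y) − (yη/log x) G^{*r}(log y/log x)‖ ≤ C₀ yη²/log x` with `C₀ = C₀(r, ε, S, K, C)`
  (induction on `r` from `shortSum_est` and `longSum_est` of `FordAsymptoticSievePrimeSums.lean`,
  the PNT `|ϑ(u) − u| ≤ C u e^{−c√log u}` entering as a hypothesis);
* `Ford2004.sum_inv_primes_le` — `∑_{x^ε ≤ p ≤ x²} 1/p ≤ 10(1+3C)/ε` from the same grid (no
  Mertens); `primeSum_one`, `primeSum_one_eq_zero`, `xThreshold_spec`.

Everything here is a theorem (plus the definitions `primeSum`, `xThreshold`); no named facts.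

## References

* K. Ford, *On Bombieri's asymptotic sieve*, Trans. AMS 357 (2005), 1663–1674, §2, Lemma 2.2
  [Ford2004].
-/

noncomputable section

open Finset Real MeasureTheory Literature.Analysis.Convolution
open scoped Chebyshev

namespace Literature.NumberTheory.Sieve.Ford2004

/-! ### Reciprocal sums over the primes of the construction -/

/-- `∑_{x^ε ≤ p ≤ x²} 1/p ≤ 10(1+3C)/ε` (a crude Mertens bound from the grid and the prime number
theorem; only boundedness matters). [folklore] -/
theorem sum_inv_primes_le {c C : ℝ} (hc : 0 < c)
    (hPNT : ∀ u : ℝ, 2 ≤ u → |θ u - u| ≤ C * u / Real.exp (c * Real.sqrt (Real.log u)))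
    {ε : ℝ} (hε : 0 < ε) (hε1 : ε ≤ 1) {x : ℝ} (hx : Real.exp 1 ≤ x) (hx2 : 2 ≤ x ^ (ε / 2))
    {c₁ : ℝ} (hc₁ : 0 < c₁) (hc₁' : c₁ ≤ c * Real.sqrt ε / 4) :
    ∑ p ∈ (primesIn 0 ⌊x ^ 2⌋₊).filter (fun p => ε ≤ tOf x p), (1 / p : ℝ) ≤
      10 * (1 + 3 * C) / ε := by
  set η := eta c₁ x with hηdef
  set L := Real.log x with hLdef
  have hx1 : 1 < x := lt_of_lt_of_le (by have := Real.add_one_le_exp (1:ℝ); linarith) hx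
  have hx0 : 0 < x := by linarith
  have hL1 : 1 ≤ L := by rw [hLdef, ← Real.log_exp 1]; exact Real.log_le_log (Real.exp_pos 1) hx
  have hL : 0 < L := by linarith
  have hη0 : 0 < η := eta_pos c₁ x
  have hη1 : η ≤ 1 := eta_le_one hc₁.le x
  have hC : 0 ≤ C := pnt_const_nonneg hPNT
  obtain ⟨hΔ0, hΔη, hNΔ, hNΔ', hN⟩ := grid_bounds hε hε1 hL1 hη0 hη1
  set Δ := Real.log (1 + η) / L with hΔdef
  set N := ⌈(2 - ε / 2) / Δ⌉₊ with hNdef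
  have hxe0 : 0 < x ^ (ε / 2) := Real.rpow_pos_of_pos hx0 _
  set u : ℕ → ℝ := fun i => x ^ (ε / 2) * (1 + η) ^ i with hudef
  have hu0 : ∀ i, 0 < u i := fun i => mul_pos hxe0 (pow_pos (by linarith) i)
  have huge : ∀ i, x ^ (ε / 2) ≤ u i := fun i =>
    le_mul_of_one_le_right hxe0.le (one_le_pow₀ (by linarith))
  have hlogu : ∀ i, ε / 2 * L ≤ Real.log (u i) := by
    intro i
    have := Real.log_le_log hxe0 (huge i)
    rwa [Real.log_rpow hx0] at this
  -- the summand, extended by zero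
  set f : ℕ → ℝ := fun p => if ε ≤ tOf x p ∧ (p : ℝ) ≤ x ^ 2 then 1 / (p : ℝ) else 0 with hfdef
  have hf0 : ∀ p, 0 ≤ f p := fun p => by
    simp only [hfdef]; split_ifs <;> positivity
  have hfle : ∀ p, f p ≤ 1 / (p : ℝ) := fun p => by
    simp only [hfdef]
    split_ifs
    · exact le_rfl
    · positivity
  have hf_zero_small : ∀ p : ℕ, p.Prime → (p : ℝ) ≤ x ^ (ε / 2) → f p = 0 := by
    intro p hp hpx
    have hp0 : (0 : ℝ) < p := by exact_mod_cast hp.pos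
    have ht : tOf x p ≤ ε / 2 := by
      rw [tOf, div_le_iff₀ hL]
      have := Real.log_le_log hp0 hpx
      rwa [Real.log_rpow hx0] at this
    simp only [hfdef]
    rw [if_neg]
    rintro ⟨h1, _⟩
    linarith
  have hf_zero_large : ∀ p : ℕ, x ^ 2 < p → f p = 0 := by
    intro p hpx
    simp only [hfdef]
    rw [if_neg]
    rintro ⟨_, h2⟩
    linarith
  have hxN : x ^ 2 ≤ u N := by
    have h1 : Real.log (x ^ 2) ≤ Real.log (u N) := by
      have : Real.log (u N) = ε / 2 * L + N * Real.log (1 + η) := by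
        simp only [hudef]
        rw [Real.log_mul hxe0.ne' (pow_pos (by linarith) N).ne', Real.log_rpow hx0, Real.log_pow]
      rw [Real.log_pow, Nat.cast_ofNat, this]
      have : (N : ℝ) * Real.log (1 + η) = N * Δ * L := by rw [hΔdef]; field_simp
      rw [this]
      nlinarith
    exact (Real.log_le_log_iff (pow_pos hx0 2) (hu0 N)).mp h1
  -- rewrite the filtered sum as a sum of `f`
  have hlhs : ∑ p ∈ (primesIn 0 ⌊x ^ 2⌋₊).filter (fun p => ε ≤ tOf x p), (1 / p : ℝ) =
      ∑ p ∈ primesIn 0 ⌊x ^ 2⌋₊, f p := by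
    rw [Finset.sum_filter]
    refine Finset.sum_congr rfl fun p hp => ?_
    obtain ⟨hp', _, h2⟩ := mem_primesIn.mp hp
    have hpx : (p : ℝ) ≤ x ^ 2 := (Nat.le_floor_iff' hp'.ne_zero).mp h2
    simp only [hfdef, hpx, and_true]
  rw [hlhs, sum_eq_sum_cells hx1 hη0.le f hf_zero_small hf_zero_large hxN]
  -- each cell
  have hcell : ∀ i, ∑ p ∈ primesIn ⌊u i⌋₊ ⌊u i * (1 + η)⌋₊, f p ≤ 2 * (1 + 3 * C) / ε * (η / L) := by
    intro i
    have hui := hu0 i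
    calc ∑ p ∈ primesIn ⌊u i⌋₊ ⌊u i * (1 + η)⌋₊, f p
        ≤ ∑ p ∈ primesIn ⌊u i⌋₊ ⌊u i * (1 + η)⌋₊, 1 / u i := by
          refine Finset.sum_le_sum fun p hp => (hfle p).trans ?_
          obtain ⟨_, h1, _⟩ := (mem_primesIn_floor hui.le).mp hp
          exact one_div_le_one_div_of_le hui h1.le
      _ = ((primesIn ⌊u i⌋₊ ⌊u i * (1 + η)⌋₊).card : ℝ) * (1 / u i) := by
          rw [Finset.sum_const, nsmul_eq_mul]
      _ ≤ (1 + 3 * C) * u i * η / Real.log (u i) * (1 / u i) := by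
          gcongr
          exact card_primesIn_window_le hc hPNT hε hx1.le hx2 hc₁ hc₁' (huge i)
      _ = (1 + 3 * C) * η / Real.log (u i) := by field_simp
      _ ≤ (1 + 3 * C) * η / (ε / 2 * L) :=
          div_le_div_of_nonneg_left (by positivity) (by positivity) (hlogu i)
      _ = 2 * (1 + 3 * C) / ε * (η / L) := by field_simp
  calc ∑ i ∈ range N, ∑ p ∈ primesIn ⌊x ^ (ε / 2) * (1 + η) ^ i⌋₊
          ⌊x ^ (ε / 2) * (1 + η) ^ i * (1 + η)⌋₊, f p
      ≤ ∑ i ∈ range N, 2 * (1 + 3 * C) / ε * (η / L) := Finset.sum_le_sum fun i _ => hcell i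
    _ = N * (2 * (1 + 3 * C) / ε * (η / L)) := by rw [Finset.sum_const, Finset.card_range, nsmul_eq_mul]
    _ ≤ 5 * L / η * (2 * (1 + 3 * C) / ε * (η / L)) := by gcongr
    _ = 10 * (1 + 3 * C) / ε := by field_simp; ring

/-! ### The iterated prime sums `Σ_r` -/

/-- Ford's iterated prime sums: `Σ_0(y) = [y < 1 ≤ y(1+η)]` and
`Σ_{r+1}(y) = ∑_{p ≤ x²} t_p G(t_p) Σ_r(y/p)`, so that
`Σ_r(y) = ∑_{(p_1,…,p_r)} [y < p_1⋯p_r ≤ y(1+η)] ∏ t_{p_i} G(t_{p_i})`, the sum over ORDERED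
`r`-tuples of primes of the left side of [Ford2004] Lemma 2.2 (interval `(y, y(1+η)]`, weight
`f(u) = ∏ u_i G(u_i)`). [cite: Ford2004, Lemma 2.2] -/
def primeSum (c₁ x : ℝ) (G : ℝ → ℂ) : ℕ → ℝ → ℂ
  | 0, y => if y < 1 ∧ 1 ≤ y * (1 + eta c₁ x) then 1 else 0
  | r + 1, y => ∑ p ∈ primesIn 0 ⌊x ^ 2⌋₊, (tOf x p : ℂ) * G (tOf x p) * primeSum c₁ x G r (y / p)

/-- Unfolding `Σ_0`. [folklore] -/
theorem primeSum_zero (c₁ x : ℝ) (G : ℝ → ℂ) (y : ℝ) :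
    primeSum c₁ x G 0 y = if y < 1 ∧ 1 ≤ y * (1 + eta c₁ x) then 1 else 0 := rfl

/-- Unfolding `Σ_{r+1}` as a sum over the first prime. [folklore] -/
theorem primeSum_succ (c₁ x : ℝ) (G : ℝ → ℂ) (r : ℕ) (y : ℝ) :
    primeSum c₁ x G (r + 1) y =
      ∑ p ∈ primesIn 0 ⌊x ^ 2⌋₊, (tOf x p : ℂ) * G (tOf x p) * primeSum c₁ x G r (y / p) := rfl

/-- `Σ_1(y) = ∑_{y < p ≤ y(1+η)} t_p G(t_p)` when `y(1+η) ≤ x²`. [folklore] -/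
theorem primeSum_one {c₁ x : ℝ} (G : ℝ → ℂ) {y : ℝ} (hy : 0 ≤ y) (hyx : y * (1 + eta c₁ x) ≤ x ^ 2) :
    primeSum c₁ x G 1 y =
      ∑ p ∈ primesIn ⌊y⌋₊ ⌊y * (1 + eta c₁ x)⌋₊, (tOf x p : ℂ) * G (tOf x p) := by
  rw [primeSum_succ]
  simp only [primeSum_zero, mul_ite, mul_one, mul_zero]
  rw [← Finset.sum_filter]
  refine Finset.sum_congr ?_ fun p _ => rfl
  ext p
  rw [Finset.mem_filter, mem_primesIn, mem_primesIn_floor hy]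
  constructor
  · rintro ⟨⟨hp, _, _⟩, h1, h2⟩
    have hp0 : (0 : ℝ) < p := by exact_mod_cast hp.pos
    refine ⟨hp, (div_lt_one hp0).mp h1, ?_⟩
    rwa [div_mul_eq_mul_div, le_div_iff₀ hp0, one_mul] at h2
  · rintro ⟨hp, h1, h2⟩
    have hp0 : (0 : ℝ) < p := by exact_mod_cast hp.pos
    refine ⟨⟨hp, hp.pos, ?_⟩, (div_lt_one hp0).mpr h1, ?_⟩
    · exact (Nat.le_floor_iff' hp.ne_zero).mpr (h2.trans hyx)
    · rwa [div_mul_eq_mul_div, le_div_iff₀ hp0, one_mul]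

/-- `Σ_1(y) = 0` when `2 y < x^ε` and `G` vanishes below `ε`. [folklore] -/
theorem primeSum_one_eq_zero {c₁ x ε : ℝ} (hx : 1 < x) (hc₁ : 0 ≤ c₁) (G : ℝ → ℂ)
    (hG : ∀ t, G t ≠ 0 → ε ≤ t) {y : ℝ} (hy : 0 < y) (hyx : 2 * y < x ^ ε) :
    primeSum c₁ x G 1 y = 0 := by
  rw [primeSum_succ]
  refine Finset.sum_eq_zero fun p hp => ?_
  obtain ⟨hp', _, _⟩ := mem_primesIn.mp hp
  have hp0 : (0 : ℝ) < p := by exact_mod_cast hp'.pos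
  simp only [primeSum_zero]
  split_ifs with h
  · obtain ⟨_, h2⟩ := h
    have hpy : (p : ℝ) ≤ y * (1 + eta c₁ x) := by
      rwa [div_mul_eq_mul_div, le_div_iff₀ hp0, one_mul] at h2
    have hp2 : (p : ℝ) < x ^ ε := by
      have := eta_le_one hc₁ x
      nlinarith
    have ht : tOf x p < ε := by
      rw [tOf, div_lt_iff₀ (Real.log_pos hx)]
      have := Real.log_lt_log hp0 hp2
      rwa [Real.log_rpow (by linarith)] at this
    have hG0 : G (tOf x p) = 0 := by
      by_contra hne; exact absurd (hG _ hne) (not_le.mpr ht)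
    simp [hG0]
  · simp

/-! ### Ford's Lemma 2.2: `Σ_r(y) = (yη/log x) G^{*r}(log y/log x) + O(yη²/log x)` -/

/-- The threshold beyond which the estimates hold: `x ≥ e^{2/ε}` (so that `x^{ε/2} ≥ e ≥ 2`,
`log x ≥ 1`) and `x ≥ 16`. [folklore] -/
def xThreshold (ε : ℝ) : ℝ := max (Real.exp (2 / ε)) 16

/-- Beyond the threshold: `e ≤ x`, `2 ≤ x^{ε/2}` and `16 ≤ x`. [folklore] -/
theorem xThreshold_spec {ε x : ℝ} (hε : 0 < ε) (hε1 : ε ≤ 1) (hx : xThreshold ε ≤ x) :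
    Real.exp 1 ≤ x ∧ 2 ≤ x ^ (ε / 2) ∧ 16 ≤ x := by
  have h1 : Real.exp (2 / ε) ≤ x := (le_max_left _ _).trans hx
  have h2 : (16 : ℝ) ≤ x := (le_max_right _ _).trans hx
  have h3 : (1 : ℝ) ≤ 2 / ε := by rw [le_div_iff₀ hε]; linarith
  refine ⟨(Real.exp_le_exp.mpr h3).trans h1, ?_, h2⟩
  have hx0 : 0 < x := by linarith
  have : Real.exp 1 ≤ x ^ (ε / 2) := by
    have h4 : Real.exp (2 / ε) ^ (ε / 2) ≤ x ^ (ε / 2) :=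
      Real.rpow_le_rpow (Real.exp_pos _).le h1 (by linarith)
    rwa [← Real.exp_mul, show 2 / ε * (ε / 2) = 1 by field_simp] at h4
  have he : (2 : ℝ) ≤ Real.exp 1 := by
    have := Real.add_one_le_exp (1 : ℝ); linarith
  linarith

/-- **Ford's Lemma 2.2** (product weights, ordered tuples, interval `(y, y(1+η)]`): for a
`K`-Lipschitz `G ∈ C_c(ℝ)` bounded by `S` and living on `[ε, 2]`, for `r ≥ 1`, `x` large,
`c₁ ≤ c√ε/4` (`c` the constant of the prime number theorem `|ϑ(u) − u| ≤ C u e^{−c√log u}`) and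
`0 < y ≤ 2x`,
`Σ_r(y) = (yη/log x) G^{*r}(log y/log x) + O_{r,ε,S,K}(yη²/log x)`,
where `Σ_r(y) = ∑_{(p_1,…,p_r), y < p_1⋯p_r ≤ y(1+η)} ∏ t_{p_i} G(t_{p_i})` (`primeSum`),
`t_p = log p/log x`, `η = e^{−c₁√log x}`, and `G^{*r}` is the `r`-fold additive convolution
(`ConvFun.cpow`; `G^{*r}(Y) = ∫_{u_1+⋯+u_r = Y} ∏ G(u_i)` is Ford's `∫_{U_r} f/(u_1⋯u_r)` for
`f = ∏ u_i G(u_i)`). Proof by induction on `r` exactly as in [Ford2004]: `r = 1` is the prime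
number theorem on a short interval (`shortSum_est`), and `Σ_{r+1}(y) = ∑_p t_p G(t_p) Σ_r(y/p)`
is evaluated by the induction hypothesis and the long-range sum `longSum_est`.
[cite: Ford2004, Lemma 2.2] -/
theorem primeSum_est {c C : ℝ} (hc : 0 < c)
    (hPNT : ∀ u : ℝ, 2 ≤ u → |θ u - u| ≤ C * u / Real.exp (c * Real.sqrt (Real.log u)))
    {ε : ℝ} (hε : 0 < ε) (hε1 : ε ≤ 1) {S K : ℝ} (hS0 : 0 ≤ S) (hK0 : 0 ≤ K) {r : ℕ} (hr : 1 ≤ r) :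
    ∃ C₀ : ℝ, 0 ≤ C₀ ∧ ∀ x : ℝ, xThreshold ε ≤ x → ∀ c₁ : ℝ, 0 < c₁ → c₁ ≤ c * Real.sqrt ε / 4 →
      ∀ G : ConvFun, (∀ t, ‖G t‖ ≤ S) → (∀ t t', ‖G t - G t'‖ ≤ K * |t - t'|) → G.SuppIn ε 2 →
        ∀ y : ℝ, 0 < y → y ≤ 2 * x →
          ‖primeSum c₁ x G r y -
              ((y * eta c₁ x / Real.log x : ℝ) : ℂ) * G.cpow r (Real.log y / Real.log x)‖ ≤
            C₀ * y * eta c₁ x ^ 2 / Real.log x := by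
  have hC : 0 ≤ C := pnt_const_nonneg hPNT
  induction r, hr using Nat.le_induction with
  | base =>
    refine ⟨3 * C * S + K * (1 + 3 * C), by positivity, ?_⟩
    intro x hx c₁ hc₁ hc₁' G hS hK hsupp y hy0 hy2x
    obtain ⟨hxe, hx2, hx16⟩ := xThreshold_spec hε hε1 hx
    have hx1 : 1 < x := lt_of_lt_of_le (by have := Real.add_one_le_exp (1:ℝ); linarith) hxe
    have hx0 : 0 < x := by linarith
    have hL : 0 < Real.log x := Real.log_pos hx1
    have hη0 : 0 < eta c₁ x := eta_pos c₁ x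
    have hη1 : eta c₁ x ≤ 1 := eta_le_one hc₁.le x
    rw [ConvFun.cpow_one]
    by_cases hy : x ^ (ε / 2) ≤ y
    · -- the short-sum estimate
      have hyx : y * (1 + eta c₁ x) ≤ x ^ 2 := by nlinarith
      rw [primeSum_one G hy0.le hyx]
      exact shortSum_est hc hPNT hε hxe hx2 hc₁ hc₁' G hS hK hy
    · -- both sides vanish
      push Not at hy
      have h2y : 2 * y < x ^ ε := by
        have : x ^ ε = x ^ (ε / 2) * x ^ (ε / 2) := by
          rw [← Real.rpow_add hx0]; ring_nf
        rw [this]; nlinarith [Real.rpow_pos_of_pos hx0 (ε / 2)]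
      rw [primeSum_one_eq_zero hx1 hc₁.le G (fun t ht => (hsupp t ht).1) hy0 h2y]
      have hGY : G (Real.log y / Real.log x) = 0 := by
        apply hsupp.eq_zero
        left
        rw [div_lt_iff₀ hL]
        have := Real.log_lt_log hy0 hy
        rw [Real.log_rpow hx0] at this
        nlinarith
      rw [hGY, mul_zero, sub_zero, norm_zero]
      positivity
  | succ r hr ih =>
    obtain ⟨Cr, hCr0, IH⟩ := ih
    -- constants
    set Sr : ℝ := (2 * S) ^ (r - 1) * S with hSrdef
    set Kr : ℝ := (2 * S) ^ (r - 1) * K with hKrdef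
    set SF : ℝ := S * Sr with hSFdef
    set KF : ℝ := K * Sr + S * Kr with hKFdef
    set CB : ℝ := A₁ C ε * SF + A₂ C * KF with hCBdef
    set CM : ℝ := 10 * (1 + 3 * C) / ε with hCMdef
    have hSr0 : 0 ≤ Sr := by positivity
    have hKr0 : 0 ≤ Kr := by positivity
    have hA₁ : 0 ≤ A₁ C ε := by rw [A₁]; positivity
    have hA₂ : 0 ≤ A₂ C := by rw [A₂]; positivity
    have hCB0 : 0 ≤ CB := by positivity
    have hCM0 : 0 ≤ CM := by positivity
    refine ⟨2 * S * Cr * CM + CB, by positivity, ?_⟩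
    intro x hx c₁ hc₁ hc₁' G hS hK hsupp y hy0 hy2x
    obtain ⟨hxe, hx2, hx16⟩ := xThreshold_spec hε hε1 hx
    have hx1 : 1 < x := lt_of_lt_of_le (by have := Real.add_one_le_exp (1:ℝ); linarith) hxe
    have hx0 : 0 < x := by linarith
    set η := eta c₁ x with hηdef
    set L := Real.log x with hLdef
    have hL : 0 < L := Real.log_pos hx1
    have hη0 : 0 < η := eta_pos c₁ x
    set Y := Real.log y / L with hYdef
    have hr0 : r ≠ 0 := by omega
    -- size of `G^{*r}`
    have hI : ∫ t, ‖G t‖ ≤ 2 * S := by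
      have := G.integral_norm_le hS hsupp (by linarith)
      nlinarith
    have hI0 : 0 ≤ ∫ t, ‖G t‖ := G.integral_norm_nonneg
    have hIpow : (∫ t, ‖G t‖) ^ (r - 1) ≤ (2 * S) ^ (r - 1) := pow_le_pow_left₀ hI0 hI _
    have hGr : ∀ s, ‖G.cpow r s‖ ≤ Sr := fun s =>
      (G.norm_cpow_le hS hr0 s).trans (mul_le_mul_of_nonneg_right hIpow hS0)
    have hGrK : ∀ s s', ‖G.cpow r s - G.cpow r s'‖ ≤ Kr * |s - s'| := fun s s' =>
      (G.norm_cpow_sub_le hK hr0 s s').trans (by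
        rw [hKrdef]
        exact mul_le_mul_of_nonneg_right (mul_le_mul_of_nonneg_right hIpow hK0) (abs_nonneg _))
    -- the function `F(t) = G(t) G^{*r}(Y - t)` of the long-range sum
    set F : ℝ → ℂ := fun t => G t * G.cpow r (Y - t) with hFdef
    have hFS : ∀ t, ‖F t‖ ≤ SF := fun t => by
      rw [hFdef]; dsimp only; rw [norm_mul, hSFdef]
      exact mul_le_mul (hS t) (hGr _) (norm_nonneg _) hS0
    have hFK : ∀ t t', ‖F t - F t'‖ ≤ KF * |t - t'| := by
      intro t t'
      have h1 : F t - F t' = (G t - G t') * G.cpow r (Y - t) + G t' * (G.cpow r (Y - t) - G.cpow r (Y - t')) := by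
        simp only [hFdef]; ring
      rw [h1]
      refine (norm_add_le _ _).trans ?_
      rw [norm_mul, norm_mul]
      have h2 : |Y - t - (Y - t')| = |t - t'| := by
        rw [show Y - t - (Y - t') = -(t - t') by ring, abs_neg]
      calc ‖G t - G t'‖ * ‖G.cpow r (Y - t)‖ + ‖G t'‖ * ‖G.cpow r (Y - t) - G.cpow r (Y - t')‖
          ≤ K * |t - t'| * Sr + S * (Kr * |Y - t - (Y - t')|) :=
            add_le_add (mul_le_mul (hK t t') (hGr _) (norm_nonneg _) (by positivity))
              (mul_le_mul (hS t') (hGrK _ _) (norm_nonneg _) hS0)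
        _ = KF * |t - t'| := by rw [h2, hKFdef]; ring
    have hFsupp : ∀ t, F t ≠ 0 → ε ≤ t ∧ t ≤ 2 := fun t ht =>
      hsupp t (left_ne_zero_of_mul ht)
    have hlong := longSum_est hc hPNT hε hε1 hxe hx2 hc₁ hc₁' F hFS hFK hFsupp
    -- `∫ F = G^{*(r+1)}(Y)`
    have hintF : ∫ t, F t = G.cpow (r + 1) Y := by
      rw [ConvFun.cpow_succ G hr0, ConvFun.mul_apply]
    -- split the difference
    set P := primesIn 0 ⌊x ^ 2⌋₊ with hPdef
    have hdecomp : primeSum c₁ x G (r + 1) y - ((y * η / L : ℝ) : ℂ) * G.cpow (r + 1) Y =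
        ∑ p ∈ P, (tOf x p : ℂ) * G (tOf x p) *
            (primeSum c₁ x G r (y / p) - (((y / p) * η / L : ℝ) : ℂ) * G.cpow r (Y - tOf x p)) +
          ((y * η / L : ℝ) : ℂ) * (∑ p ∈ P, ((tOf x p / p : ℝ) : ℂ) * F (tOf x p) - ∫ t, F t) := by
      rw [hintF, primeSum_succ, mul_sub, Finset.mul_sum, ← hPdef]
      have : ∀ p ∈ P, (tOf x p : ℂ) * G (tOf x p) * primeSum c₁ x G r (y / p) =
          (tOf x p : ℂ) * G (tOf x p) *
              (primeSum c₁ x G r (y / p) - (((y / p) * η / L : ℝ) : ℂ) * G.cpow r (Y - tOf x p)) +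
            ((y * η / L : ℝ) : ℂ) * (((tOf x p / p : ℝ) : ℂ) * F (tOf x p)) := by
        intro p hp
        simp only [hFdef]
        push_cast
        ring
      rw [Finset.sum_congr rfl this, Finset.sum_add_distrib]
      ring
    rw [hdecomp]
    -- first piece: induction hypothesis at `y/p`, summed with `∑ 1/p = O(1)`
    have hfirst : ‖∑ p ∈ P, (tOf x p : ℂ) * G (tOf x p) *
        (primeSum c₁ x G r (y / p) - (((y / p) * η / L : ℝ) : ℂ) * G.cpow r (Y - tOf x p))‖ ≤
        2 * S * Cr * CM * (y * η ^ 2 / L) := by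
      have hterm : ∀ p ∈ P, ‖(tOf x p : ℂ) * G (tOf x p) *
          (primeSum c₁ x G r (y / p) - (((y / p) * η / L : ℝ) : ℂ) * G.cpow r (Y - tOf x p))‖ ≤
          2 * S * Cr * (y * η ^ 2 / L) * (if ε ≤ tOf x p then 1 / (p : ℝ) else 0) := by
        intro p hp
        obtain ⟨hp', _, _⟩ := mem_primesIn.mp hp
        have hp0 : (0 : ℝ) < p := by exact_mod_cast hp'.pos
        by_cases hG0 : G (tOf x p) = 0
        · rw [hG0, mul_zero, zero_mul, norm_zero]
          positivity
        obtain ⟨ht1, ht2⟩ := hsupp _ hG0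
        rw [if_pos ht1]
        have hIH := IH x hx c₁ hc₁ hc₁' G hS hK hsupp (y / p) (div_pos hy0 hp0)
          ((div_le_self hy0.le (by exact_mod_cast hp'.one_lt.le)).trans hy2x)
        have hlogyp : Real.log (y / p) / Real.log x = Y - tOf x p := by
          rw [hYdef, tOf, Real.log_div hy0.ne' hp0.ne', sub_div]
        rw [hlogyp] at hIH
        have hcast : (((y / p) * eta c₁ x / Real.log x : ℝ) : ℂ) = (((y / p) * η / L : ℝ) : ℂ) := rfl
        rw [norm_mul, norm_mul, Complex.norm_real, Real.norm_eq_abs, abs_of_nonneg (by linarith)]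
        calc tOf x p * ‖G (tOf x p)‖ *
              ‖primeSum c₁ x G r (y / p) - (((y / p) * η / L : ℝ) : ℂ) * G.cpow r (Y - tOf x p)‖
            ≤ 2 * S * (Cr * (y / p) * η ^ 2 / L) :=
              mul_le_mul (mul_le_mul ht2 (hS _) (norm_nonneg _) (by norm_num)) hIH (norm_nonneg _)
                (by positivity)
          _ = 2 * S * Cr * (y * η ^ 2 / L) * (1 / (p : ℝ)) := by field_simp
      calc ‖∑ p ∈ P, (tOf x p : ℂ) * G (tOf x p) *
              (primeSum c₁ x G r (y / p) - (((y / p) * η / L : ℝ) : ℂ) * G.cpow r (Y - tOf x p))‖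
          ≤ ∑ p ∈ P, 2 * S * Cr * (y * η ^ 2 / L) * (if ε ≤ tOf x p then 1 / (p : ℝ) else 0) :=
            (norm_sum_le _ _).trans (Finset.sum_le_sum hterm)
        _ = 2 * S * Cr * (y * η ^ 2 / L) * ∑ p ∈ P.filter (fun p => ε ≤ tOf x p), (1 / p : ℝ) := by
            rw [← Finset.mul_sum, Finset.sum_filter]
        _ ≤ 2 * S * Cr * (y * η ^ 2 / L) * CM := by
            gcongr
            exact sum_inv_primes_le hc hPNT hε hε1 hxe hx2 hc₁ hc₁'
        _ = 2 * S * Cr * CM * (y * η ^ 2 / L) := by ring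
    -- second piece: the long-range sum
    have hsecond : ‖((y * η / L : ℝ) : ℂ) * (∑ p ∈ P, ((tOf x p / p : ℝ) : ℂ) * F (tOf x p) - ∫ t, F t)‖ ≤
        CB * (y * η ^ 2 / L) := by
      rw [norm_mul, Complex.norm_real, Real.norm_eq_abs, abs_of_nonneg (by positivity)]
      calc y * η / L * ‖∑ p ∈ P, ((tOf x p / p : ℝ) : ℂ) * F (tOf x p) - ∫ t, F t‖
          ≤ y * η / L * (CB * η) := mul_le_mul_of_nonneg_left hlong (by positivity)
        _ = CB * (y * η ^ 2 / L) := by ring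
    calc _ ≤ _ := norm_add_le _ _
      _ ≤ 2 * S * Cr * CM * (y * η ^ 2 / L) + CB * (y * η ^ 2 / L) := add_le_add hfirst hsecond
      _ = (2 * S * Cr * CM + CB) * y * η ^ 2 / L := by ring

end Literature.NumberTheory.Sieve.Ford2004
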